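import Summits.NavierStokesRegularity.OSWSelfSimilar.CertificateViscousSheetR
import HarnessLib
/-!
# Viscous gCLM/OSW profile sheet on the LINE (zone Z3, SHEET-ℝ), case Z3-SR-SPEC: the LINEARISED SPECTRUM at the certified point
# `(a, c_l, ε) = (1/5, 1/2, 1)` — transcript of the spectral certificate of implementation 1, kernel-checked inequalities only
HONEST FRAMING (cell ns-blowup GROUP B «PROFILE SEARCH», human rulings D-0035/D-0074/D-0081; PROFILE-SPEC v1.3 case Z3-SR-SPEC, profile-lead
RULINGS (ds)/(dx)(4)/(eb)(2)/(ee)(1)/(ei)(1); PREREG `HOME/profile/cert/impl1/sheetR/spec/PREREG-SHEET-R-SPEC.md` sha16 fad67dc3bd2becee + codicil,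
RUNBOOK `RUNBOOK-SPEC-impl1.md`): **1-D MODEL (viscous gCLM/OSW on `ℝ` at the NS-type similarity exponent `c_l = 1/2`), computer-assisted;
not Euler/NS; «violates: none — MODEL»; census hook `Literature.Analysis.FluidPDE.effectiveViscosity_half`.** Nothing here is a statement
about Navier–Stokes. Companion of the existence row `CertificateViscousSheetR` (the certified odd zero `Ω*`, `‖Ω* − Ω̄‖_E ≤ rE♯₂ = 6.80e-6`, whose
literals `Llip`, `rEsharp2` are imported).
THE OBJECT: the pencil `σ ↦ DG(Ω*) + σJ : E → X*` (`E` = odd `H¹_w`, `w = 64 + ξ²`, `‖δ‖²_E = ‖δ′‖²_w + ¼‖δ‖²_w` — the E-norm OF RECORD —, `J` the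
`w`-pairing) of the profile map `G(Ω) = Ω + ½ξΩ′ + a𝒰Ω′ − (HΩ)Ω − Ω″`, and the rank-one–lifted operator `A_F := DG(Ω̄) + F`, `Fδ := θ⟨h, wδ⟩·Jh`
(`θ = 4`, `h` = the 12 frame-mode dyadics of record, used in BOTH slots), with its Evans function `E(σ) := 1 − θ⟨h, w(A_F + σJ)⁻¹Jh⟩`.
WHAT THE CERTIFICATE SAYS (pre-lettered word, RULING (dx)(4)): «Z3-SR-SPEC: CERTIFIED SPECTRAL STABILITY MODULO GAUGE of the sheet-ℝ MODEL profile Ω* at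
(a, c_l, ν) = (0.2, ½, 1) in the odd class E = odd H¹_{64+ξ²}: σ_p(−DG(Ω*)|_E) ∩ {Re σ ≥ −0.03} = {1} = the T-shift gauge mode, simple; n_u^× = 0 (ODD half certified,
even half = eng-3's float); certified gap ≥ 0.03 (float 0.369); essential spectrum ⊂ {Re σ ≤ −0.15}; one implementation (F5(a))».
1. **S1 (coercivity of `A_F`).** `q_γ(δ) := ⟨A_Fδ, wδ⟩ − γ‖δ‖²_w ≥ c₁‖δ‖²_w + c₂‖δ′‖²_w` on `E` (`γ = 1/20`, `c₁ = 1/10`, `c₂ = 1/5`, `t = 1`, `N = 1600`,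
   `ε̄ = 527/10⁴ ≥ ε_N = 32D/(N+1)`, `D = 2.63430`; `m₀ = ¼ − γ − c₁ − ε̄`, `d₀ = 1 − c₂ − ε̄/2`, `c_𝔅 = min(d₀, 4m₀)`), certified in the GRAM FORM of the
   prereg (P2 (S1)): `Q ≥ β − ΨᵀSΨ` and `β − ΨᵀSΨ ≥ 0 on E ⟺ 𝒢 − 𝒢S𝒢 ≽ 0` for the functional family `Ψ = (⟨e_m, w·⟩, m ≤ N; φ̃_j, j ≤ J)`
   (head functionals + `J` tail combinations of the `q_n = P†e_n`, the head parts of the `q_n` sitting EXACTLY in `S`, the tiny ones dropped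
   against the free slack `ε_free = ε̄ − ε_N`); second-order Gram `𝒢 = 𝒢̂ + ℰ`, `0 ≼ ℰ ≼ d·I`; `𝒢 − 𝒢S𝒢 ≽ (𝒢̂ − 𝒢̂S𝒢̂) − d′·𝒢̂SᵀS𝒢̂`,
   `d′ = d/(1 − ‖S‖d)`; certified `λ_min > 0` of the scaled matrix. Literals below: `epsTau`, `epsDrop`, `epsTailM` (UP), `dGram` (UP), `normS` (UP),
   `lamCert` (DOWN). Consequence for `Ω*` (P8, `Δ := Llip·rEsharp2 ≥ ‖DG(Ω*) − DG(Ω̄)‖_{E→X*}`): `q*_γ ≥ (c₁ − Δ/4)‖δ‖²_w + (c₂ − Δ)‖δ′‖²_w`.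
2. **S2 (the Evans function on the contour).** Far field (ORDER 2): `|k(σ)| ≤ A₁/|σ| + A₂/|σ|²` for `Re σ ≥ −0.03` (`A₁ ≥ θ‖h‖²_w + θ‖h‖_w S₁/c_w`,
   `A₂ ≥ θ|⟨h, a₁⟩_w| + θ‖h‖_w(‖a₂‖_w + S₂)/c_w`, `c_w = c₁ + γ − γ′ = 3/25`), `|k* − k| ≤ pert := 16θ·Δ‖h‖²_w/(c_E c_E*)`; `R₀ = 12.51`:
   `A₁/R₀ + A₂/R₀² + pert < 1`; contour = segment `Re σ = −0.03`, `|Im σ| ≤ 12.7` + the arcs `|σ| = 12.7` (clockwise; `W = −#zeros`): 23 segment points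
   (upper half), each sub-arc closed by a CERTIFIED Taylor step radius from ADJOINT chains (`k_j = θ(−1)^j⟨y_{j+1}, h⟩_w`, `𝒜(σ)ᵀy_{j+1} = Jy_j`), with
   `min_k|E(σ_k)| ≥ 0.4530 > 3·pert`, `Re E > 0` on the arcs; winding `W ∈ [−1 ± 1.3e-5]` (`Ω̄`) and `W* ∈ [−1 ± 0.13]` (`Ω*`) ⇒ `W = W* = −1`:
   EXACTLY ONE zero of `E*` in `{Re σ ≥ −0.03}` counted with multiplicity — the gauge eigenvalue `σ = 1` (eigenvector `Ω* + ½ξΩ*′`, P6).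
IMPLEMENTATION 1 (seat ns-blowup-profile-cert-1 g4/g5): python-flint/Arb 212/160-bit balls; centre of record `c4de65e13d80c930`; float stage v2 `fea872dd34516d34`
(T₂-free local solves); interval outputs: S1 e-shards `a788c53cd4f22436` `b924d809b33c48d5` `96ea9b9c99a5b3e2` `15133a6ad666b24f`, S1 Gram prep/cert (kit j267189 /
j267443: prep `f0ab36701fef3ee8`, certificate `61f7e9f0f014ce73`), far field `245f0c91c6a4b8c5` (j265983), contour close `5e91c78d6f5fd70a` (j267258); code `HOME/profile/cert/impl1/sheetR/spec/code/`.
3. NO `def … : Prop` hypotheses. **What is NOT kernel-checked:** (i) that the printed numbers bound the analytic quantities — the ball arithmetic of the impl-1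
   programs and their ζ-series bookkeeping; (ii) the paper chain: (P1) the complex-`σ` Re-coercive Lax–Milgram / two-norm resolvent bound and (P2) the rank-one
   kernel criterion `ker(DG + σJ) ≠ 0 ⟺ E(σ) = 0` and the analyticity of `E` — KERNEL IN THE ABSTRACT:
   `Literature.Analysis.OperatorTheory.CoercivePencilResolvent` (`norm_pivot_ring_inverse_pencil_le`, `pencil_rankOne_kernel_iff`, `analyticOnNhd_evans`),
   `…FiniteRankCapacitance.capUnit`, over `ℝ`: `…CoerciveFiniteRankInverse.exists_inverse_of_coercive`; (P3) the Gram lemma `β − ΨᵀSΨ ≥ 0 ⟺ 𝒢 − 𝒢S𝒢 ≽ 0`,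
   the second-order Gram identity `𝒢 − 𝒢̂ = [β(ε_i, ε_j)] ≼ (Σρ_i²)I` and the perturbation lemma above; (P4) the output high-pass lemma (E5) — KERNEL frame
   side `SheetRHighPass.highPass_weightedSq_le` — and the frame identities (E1)/(E2); the series of record `SheetRFarFieldT2SineSeries` (`t_k`),
   `SheetRGudermannianSeries` (telescoping tail) used by the far field; (P5) the argument principle on the half-disc with the step rule
   `|E(σ) − E(σ_k)| < |E(σ_k)|` ⇒ principal increments (KERNEL analogue on rectangles: `Literature.Analysis.Complex.WindingCertificate`,
   `…ArgumentPrincipleRectangle`) and «order of the zero of `E` = algebraic multiplicity of the eigenvalue of the holomorphic pencil» [Gohberg–Sigal 1971;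
   Gohberg–Goldberg–Kaashoek I, Ch. XI]; (P6) `σ = 1` is an eigenvalue with eigenvector `Ω* + ½ξΩ*′ ∈ E`; (P7) the Taylor remainder
   `θ|ε|^p‖y_p‖_w‖h‖_w/c_w(σ+ε)` and the error recursion of the adjoint chains; (P8) `Δ = L_lip·rE♯₂`; (P9)/(P10) semigroup generation and growth bound =
   spectral bound (Gearhart–Prüss) — NOT claimed: the word is SPECTRAL, not LINEAR, stability. KERNEL-checked: the inequalities below on the printed literals.
-/

namespace Summit.NavierStokesRegularity.OSWSelfSimilar
namespace CertificateViscousSheetRSpectrum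

open CertificateViscousSheetR (Llip rEsharp2)

/-! ### Registered constants -/
/-- Head rank `N` of the high-pass split (fallback value of the prereg, invoked by the codicil). [folklore] -/
def N : ℕ := 1600
/-- Lift strength `θ`. [folklore] -/
def theta : ℚ := 4
/-- Gap parameter `γ` of S1. [folklore] -/
def gamma : ℚ := (1 : ℚ) / 20
/-- Printed gap `γ′` (contour line `Re σ = −γ′`). [folklore] -/
def gammaP : ℚ := (3 : ℚ) / 100
/-- `c₁` of S1. [folklore] -/
def c1 : ℚ := (1 : ℚ) / 10
/-- `c₂` of S1. [folklore] -/
def c2 : ℚ := (1 : ℚ) / 5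
/-- Conservative high-pass constant `D` of record (Volterra form, UP). [folklore] -/
def Dcons : ℚ := (26343 : ℚ) / 10000
/-- The ε-literal `ε̄ = 527/10⁴` used in both the float and the interval stages. [folklore] -/
def epsBar : ℚ := (527 : ℚ) / 10000
/-- `ε_N = 32·D/(N+1)` at the literals. [folklore] -/
def epsN : ℚ := 32 * Dcons / ((N : ℚ) + 1)
/-- Free slack `ε_free = ε̄ − ε_N` of the literal over the formula (absorbs the dropped tail functionals). [folklore] -/
def epsFree : ℚ := epsBar - epsN
/-- Pointwise margin `m₀ = ¼ − (γ + c₁ + ε̄)` of the base form. [folklore] -/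
def m0 : ℚ := (1 : ℚ) / 4 - (gamma + c1 + epsBar)
/-- Pointwise margin `d₀ = 1 − (c₂ + ε̄/2)` of the base form. [folklore] -/
def d0 : ℚ := 1 - (c2 + epsBar / 2)
/-- Coercivity constant `c_𝔅 = min(d₀, 4m₀)` of the base form w.r.t. `‖·‖_E`. [folklore] -/
def cBB : ℚ := min d0 (4 * m0)
/-- `c_w = c₁ + γ − γ′`: the `w`-coercivity available on `Re σ ≥ −γ′`. [folklore] -/
def cw : ℚ := c1 + gamma - gammaP
/-- `Δ = L_lip·rE♯₂ ≥ ‖DG(Ω*) − DG(Ω̄)‖_{E→X*}` (from the existence row). [folklore] -/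
def Delta : ℚ := Llip * rEsharp2

/-- The literal dominates the formula: `ε_N ≤ ε̄`. [folklore] -/
theorem epsN_le_epsBar : epsN ≤ epsBar := by norm_num [epsN, epsBar, Dcons, N]
/-- `ε_free ≥ 4.69e-5`. [folklore] -/
theorem epsFree_ge : (469 : ℚ) / 10000000 ≤ epsFree := by norm_num [epsFree, epsN, epsBar, Dcons, N]
/-- `m₀ = 0.0473 > 0`. [folklore] -/
theorem m0_eq : m0 = (473 : ℚ) / 10000 := by norm_num [m0, gamma, c1, epsBar]
/-- `d₀ = 0.77365 > 0`. [folklore] -/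
theorem d0_eq : d0 = (15473 : ℚ) / 20000 := by norm_num [d0, c2, epsBar]
/-- `c_𝔅 = 4m₀ = 0.1892` (the `W`-margin is the active one). [folklore] -/
theorem cBB_eq : cBB = (473 : ℚ) / 2500 := by norm_num [cBB, d0_eq, m0_eq]
/-- `c_𝔅 > 0`. [folklore] -/
theorem cBB_pos : 0 < cBB := by rw [cBB_eq]; norm_num
/-- `c_w = 3/25`. [folklore] -/
theorem cw_eq : cw = (3 : ℚ) / 25 := by norm_num [cw, c1, gamma, gammaP]
/-- `Δ ≤ 1.31e-5`. [folklore] -/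
theorem Delta_le : Delta ≤ (131 : ℚ) / 10000000 := by norm_num [Delta, Llip, rEsharp2]
/-- The exact Ω*-constants stay positive: `c₁ − Δ/4 > 0`, `c₂ − Δ > 0`, `c_w − Δ/4 > 0`. [folklore] -/
theorem star_constants_pos : 0 < c1 - Delta / 4 ∧ 0 < c2 - Delta ∧ 0 < cw - Delta / 4 := by
  refine ⟨?_, ?_, ?_⟩ <;> norm_num [c1, c2, cw, gamma, gammaP, Delta, Llip, rEsharp2]

/-! ### S1 — the Gram certificate (literals of `spec_S1_L8_N1600_gram.json`) -/
/-- `ε_τ ≥ (Σ_{n ≤ n_excl} ‖q_n^⊥‖²_w)^{1/2}/√G_w` (UP): the excluded tiny tail functionals. [folklore] -/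
def epsTau : ℚ := (11323 : ℚ) / 1000000000
/-- `ε_drop ≥ ‖(I − TTᵀ)Q^⊥_band‖/G_w` (UP): the SVD-dropped band combinations. [folklore] -/
def epsDrop : ℚ := (4964 : ℚ) / 1000000000
/-- `ε_tailM` (UP): the band functionals' content beyond frame mode `M = 4096`. [folklore] -/
def epsTailM : ℚ := (971 : ℚ) / 10000000000
/-- `d ≥ Σ_i ρ_i²` over the functional family (UP): bound of the error Gram `ℰ`. [folklore] -/
def dGram : ℚ := (5435 : ℚ) / 10000000000
/-- `‖S‖ ≤ normS` (Frobenius, UP). [folklore] -/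
def normS : ℚ := (3045 : ℚ) / 100000
/-- Certified lower bound (DOWN) of `λ_min(D(𝒢̂ − 𝒢̂S𝒢̂ − d′𝒢̂SᵀS𝒢̂)D)`, `D = diag(𝒢̂)^{-1/2}`. [folklore] -/
def lamCert : ℚ := (22462 : ℚ) / 1000000000

/-- The dropped functionals fit into the free slack: `ε_τ + ε_drop + ε_tailM ≤ ε_free`. [folklore] -/
theorem eps_budget : epsTau + epsDrop + epsTailM ≤ epsFree := by
  norm_num [epsTau, epsDrop, epsTailM, epsFree, epsN, epsBar, Dcons, N]
/-- `‖S‖·d < 1` (the perturbation lemma's denominator). [folklore] -/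
theorem normS_mul_dGram_lt_one : normS * dGram < 1 := by norm_num [normS, dGram]
/-- THE S1 VERDICT INEQUALITY: the certified matrix is positive definite (`λ_min ≥ lamCert > 0`). [folklore] -/
theorem lamCert_pos : 0 < lamCert := by norm_num [lamCert]

/-! ### S2 — far field (ORDER 2; literals of `spec_S2_far_L8.json`, j265983) -/
/-- `‖h‖²_w` (UP). [folklore] -/
def hw2 : ℚ := (71872713 : ℚ) / 100000000
/-- `A₁ ≥ θ‖h‖²_w + θ‖h‖_w·S₁/c_w` (UP). [folklore] -/
def A1 : ℚ := (28751765 : ℚ) / 10000000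
/-- `A₂ ≥ θ|⟨h, a₁⟩_w| + θ‖h‖_w(‖a₂‖_w + S₂)/c_w` (UP). [folklore] -/
def A2 : ℚ := (1198967 : ℚ) / 10000
/-- `c_E = min(c₂, 4c_w)` on `Re σ ≥ −γ′`. [folklore] -/
def cE : ℚ := min c2 (4 * cw)
/-- `c_E*` for `Ω*`: `min(c₂ − Δ, 4(c_w − Δ/4))`. [folklore] -/
def cEstar : ℚ := min (c2 - Delta) (4 * (cw - Delta / 4))
/-- `pert ≥ sup|k*(σ) − k(σ)| = θΔ·(2‖h‖_w/c_E)(2‖h‖_w/c_E*)` on `Re σ ≥ −γ′` (UP literal). [folklore] -/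
def pert : ℚ := (3746 : ℚ) / 1000000
/-- Far-field radius literal `R₀ = 12.51` (UP of the certified 12.5078). [folklore] -/
def R0 : ℚ := (1251 : ℚ) / 100
/-- Arc radius `R₀c = 12.7` of the contour. [folklore] -/
def R0c : ℚ := (127 : ℚ) / 10

/-- `c_E = 1/5` and `c_E* = 1/5 − Δ`. [folklore] -/
theorem cE_eq : cE = (1 : ℚ) / 5 ∧ cEstar = (1 : ℚ) / 5 - Delta := by
  refine ⟨by norm_num [cE, c2, cw_eq], ?_⟩
  have h : (1 : ℚ) / 5 - Delta ≤ 4 * (cw - Delta / 4) := by norm_num [cw_eq, Delta, Llip, rEsharp2]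
  simpa [cEstar, c2] using min_eq_left h
/-- `pert` dominates the formula `16θΔ‖h‖²_w/(c_E·c_E*)` (no square roots: `(2‖h‖/c_E)(2‖h‖/c_E*) = 4‖h‖²/(c_E c_E*)`). [folklore] -/
theorem pert_ge : theta * Delta * (4 * hw2) / (cE * cEstar) ≤ pert := by
  rw [cE_eq.1, cE_eq.2]; norm_num [theta, Delta, Llip, rEsharp2, hw2, pert]
/-- FAR FIELD at `R₀`: `A₁/R₀ + A₂/R₀² + pert < 1`, so `|k|, |k*| < 1` for `|σ| ≥ R₀`, `Re σ ≥ −γ′` (the bound is decreasing in `|σ|`). [folklore] -/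
theorem farfield_R0 : A1 / R0 + A2 / R0 ^ 2 + pert < 1 := by norm_num [A1, A2, R0, pert]
/-- The registered ceiling holds: `R₀ ≤ 20`. [folklore] -/
theorem R0_le_twenty : R0 ≤ 20 := by norm_num [R0]
/-- The arc lies in the far field: `R₀ ≤ R₀c` and `A₁/R₀c + A₂/R₀c² + pert < 1` (`Re E > 0` on the arcs). [folklore] -/
theorem farfield_arc : R0 ≤ R0c ∧ A1 / R0c + A2 / R0c ^ 2 + pert < 1 := by
  refine ⟨by norm_num [R0, R0c], by norm_num [A1, A2, R0c, pert]⟩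

/-! ### S2 — the contour (literals of `spec_S2_L8.json`, j267258) -/
/-- Number of segment points (upper half): 21 of the list of record + `Im σ = 12.0` + the corner. [folklore] -/
def nSegmentPoints : ℕ := 23
/-- `min_k |E(σ_k)|` over the contour points (DOWN; attained at `σ = −γ′`). [folklore] -/
def minAbsE : ℚ := (4530 : ℚ) / 10000
/-- Smallest certified step radius on the segment (DOWN; at `σ = −γ′`, where the next point is `0.2127` away). [folklore] -/
def minStepRadius : ℚ := (2824 : ℚ) / 10000
/-- Largest distance between consecutive segment points that the smallest radius has to cover. [folklore] -/
def firstGap : ℚ := (2128 : ℚ) / 10000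
/-- `E(−γ′)` upper endpoint (real ball `−0.453013 ± 5.9e-7`). [folklore] -/
def EstartHi : ℚ := -(453012 : ℚ) / 1000000
/-- `E(R₀c)` lower endpoint (real ball `0.80233697 ± 1.1e-9`). [folklore] -/
def EendLo : ℚ := (802336 : ℚ) / 1000000
/-- Winding ball endpoints for `E` (`Ω̄`): `W ∈ [WloBar, WhiBar] = [−1.0000121, −0.9999879]`. [folklore] -/
def WloBar : ℚ := -(10000121 : ℚ) / 10000000
/-- see `WloBar`. [folklore] -/
def WhiBar : ℚ := -(9999879 : ℚ) / 10000000
/-- Winding ball endpoints for `E*` (`Ω*`, Δ-inflated): `W* ∈ [−1.121, −0.879]`. [folklore] -/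
def WloStar : ℚ := -(1121 : ℚ) / 1000
/-- see `WloStar`. [folklore] -/
def WhiStar : ℚ := -(879 : ℚ) / 1000
/-- THE WINDING NUMBER of `E*` around `∂D` (clockwise) and the zero count it certifies. [folklore] -/
def W : ℤ := -1
/-- Number of zeros of `E*` in `D = {Re σ ≥ −γ′, |σ| ≤ R₀}` with multiplicity (`= −W`). [folklore] -/
def nZeros : ℕ := 1

/-- The step-rule budget is positive with room: `minAbsE − 3·pert > 0` (indeed `> 0.44`). [folklore] -/
theorem step_budget_pos : (44 : ℚ) / 100 < minAbsE - 3 * pert := by norm_num [minAbsE, pert]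
/-- The smallest certified radius covers its gap: `firstGap < minStepRadius`. [folklore] -/
theorem firstGap_lt_radius : firstGap < minStepRadius := by norm_num [firstGap, minStepRadius]
/-- `E` is real and NEGATIVE at `σ = −γ′`, real and POSITIVE at `σ = R₀c` (R7). [folklore] -/
theorem E_signs : EstartHi < 0 ∧ 0 < EendLo := by refine ⟨by norm_num [EstartHi], by norm_num [EendLo]⟩
/-- The winding ball of `E` contains `−1` and no other integer. [folklore] -/
theorem W_ball_bar : WloBar ≤ (W : ℚ) ∧ (W : ℚ) ≤ WhiBar ∧ WhiBar - WloBar < 1 := by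
  refine ⟨?_, ?_, ?_⟩ <;> norm_num [WloBar, WhiBar, W]
/-- The winding ball of `E*` contains `−1` and no other integer. [folklore] -/
theorem W_ball_star : WloStar ≤ (W : ℚ) ∧ (W : ℚ) ≤ WhiStar ∧ WhiStar - WloStar < 1 := by
  refine ⟨?_, ?_, ?_⟩ <;> norm_num [WloStar, WhiStar, W]
/-- Clockwise contour: `#zeros = −W = 1`. [folklore] -/
theorem nZeros_eq_neg_W : (nZeros : ℤ) = -W := by norm_num [nZeros, W]

end CertificateViscousSheetRSpectrum
end Summit.NavierStokesRegularity.OSWSelfSimilar
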